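import Mathlib
import HarnessLib
import Literature.MathematicalPhysics.QuantumLattice.HubbardCTSliceGram
import Literature.MathematicalPhysics.QuantumLattice.HubbardSectorPhaseSpaceCount

/-!
# Route `KLProgramme` — ENGINE child (stmt-HubbardSuperconductivity-19918), `stub_engine_step_norms`: the SECTOR-RESOLVED Gram constant
# and the ENTRY bound of a sectorised normal covariance from ONE per-sector support count (BGM 2006 (2.80) at finite `(β, L)`)

Cell gate-hubbard-kl, seat hubbard-kl-k3c2-p3 (g3; α_n lane of g2).  The single-scale step `hubbardSectorKernelNorm_effAction_le_of_sectorNorm`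
takes the pulled-back slice covariance `C′ = S(F̃)ᵀ·C·S(F̃)` in Gram form with ONE constant `κ` (`‖f_X‖, ‖g_Y‖ ≤ κ`).  The tree's instance
`isGramBoundedR_sectorSub_sliceCT` (…HubbardCTSliceGram) charges the WHOLE shell `{|e_K| < Λ′}` (`κ² ∝ Λ_n = 4^{-n}`); BGM's (2.80) is the
SECTOR-resolved size `γ^{3h/2} = 8^{-n}` — the phase-space sum over ONE sector's support.  The generic Gram form is already sector-resolved
(`HubbardSectorPhaseSpaceCount.norm_sq_sectorGramF/G_le`: `‖F_X‖² ≤ ‖(βL²)⁻¹‖²·#T_X·S` for ANY set `T_X` containing the joint support of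
`F_ω` and the symbol); this file packages it:

* **`isGramBoundedR_sectorSub_normalCovariance_of_count`** — for a normal covariance with symbol `‖p‖ ≤ P` and a family `‖F_ω‖ ≤ 1` whose
  joint supports `{k : F_ω(k) ≠ 0 ∧ p(k,σ) ≠ 0}` have at most `Ns` points for EVERY `(ω, σ)`:
  `IsGramBoundedR (S(F)ᵀ·normalCovariance p·S(F)) √(‖(βL²)⁻¹‖²·(Ns·P))`;
* **`norm_sectorSub_pullback_normalCovariance_le_of_count`** — the ENTRY (sup) bound `‖C′ Y Y′‖ ≤ ‖(βL²)⁻¹‖²·(Ns·P)` (the same number: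
  closed form `sectorSub_pullback_normalCovariance_apply`, plane waves of modulus `1`);
* `isGramBoundedR_sectorSub_sliceCT_of_count`, `norm_sectorSub_sliceCT_le_of_count` — the slice `C^K_{(Λ,Λ′]}` at zero seed
  (`hubbardCovSliceCT_zero_seed`, `norm_sliceSymbolCT_le`: `P = 2βL²/Λ`), for any family with a per-sector count of `{F_ω ≠ 0} ∩ shell`.

The fat-family instance (count `≍ (Λβ)(L²Λ2^{-n})` ⇒ `κ_n² ≍ e₀·8^{-n}`) is the companion file …SectorSliceGramFat.  Pure bookkeeping over the
tree's Gram form; nothing about the model is asserted.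
-/

noncomputable section

namespace Summit.HubbardSuperconductivity.HubbardSuperconductivity.Theorems.TorusFourierL2

set_option linter.dupNamespace false -- summit = problem name (single-conjunct summit), D-0017

open Finset Literature.MathematicalPhysics.QuantumLattice Literature.Probability.LatticeModels
open scoped InnerProductSpace ComplexConjugate

variable {L M N : ℕ} [NeZero L]

/-- Two charges `a, b : Fin 2` with `[a = 0] = [b = 0]` are equal. -/
private theorem fin_two_eq_of_decide_eq' {a b : Fin 2} (h : decide (a = 0) = decide (b = 0)) : a = b := by
  fin_cases a <;> fin_cases b <;> simp_all

/-! ## §1 Generic: Gram constant and entry bound from one per-sector count -/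

/-- **Sector-resolved Gram constant of a sectorised normal covariance** (BGM 2006 (2.80) at finite `(β, L)`): if `‖p‖ ≤ P`, `‖F_ω‖ ≤ 1` and
every joint support `{k : F_ω(k) ≠ 0 ∧ p(k,σ) ≠ 0}` has at most `Ns` points, then `S(F)ᵀ·normalCovariance p·S(F)` is replica-Gram-bounded with
`κ = √(‖(βL²)⁻¹‖²·(Ns·P))`. [cite: BenfattoGiulianiMastropietro2006, §2.8 (2.80)] -/
theorem isGramBoundedR_sectorSub_normalCovariance_of_count [NeZero M] (β : ℝ) (F : Fin N → FreqMomentum L M → ℂ)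
    (hF : ∀ ω k, ‖F ω k‖ ≤ 1) (p : FreqMomentum L M × Fin 2 → ℂ) {P : ℝ} (hP0 : 0 ≤ P) (hp : ∀ ks, ‖p ks‖ ≤ P) {Ns : ℝ}
    (hN : ∀ (ω : Fin N) (σ : Fin 2),
      (((univ : Finset (FreqMomentum L M)).filter fun k => F ω k ≠ 0 ∧ p (k, σ) ≠ 0).card : ℝ) ≤ Ns) :
    IsGramBoundedR ((sectorSubMatrix L M β F).transpose * normalCovariance L M p * sectorSubMatrix L M β F)
      (Real.sqrt (‖((1 / (β * (L : ℝ) ^ 2) : ℝ) : ℂ)‖ ^ 2 * (Ns * P))) := by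
  classical
  -- the per-sector phase-space bound `‖F_Y‖², ‖G_Y‖² ≤ ‖(βL²)⁻¹‖²·(Ns·P)`
  have hsup : ∀ (ω : Fin N) (σ : Fin 2) (k : FreqMomentum L M), ‖F ω k‖ ^ 2 * ‖p (k, σ)‖ ≤ P := by
    intro ω σ k
    have h1 : ‖F ω k‖ ^ 2 ≤ 1 := by
      have := hF ω k
      nlinarith [norm_nonneg (F ω k)]
    calc ‖F ω k‖ ^ 2 * ‖p (k, σ)‖ ≤ 1 * P := mul_le_mul h1 (hp (k, σ)) (norm_nonneg _) zero_le_one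
      _ = P := one_mul P
  have hFY : ∀ Y : SpaceTimeIdx L M × SectorLeg N,
      ‖sectorGramF L M β F p Y‖ ^ 2 ≤ ‖((1 / (β * (L : ℝ) ^ 2) : ℝ) : ℂ)‖ ^ 2 * (Ns * P) := by
    intro Y
    set T := (univ : Finset (FreqMomentum L M)).filter fun k => F Y.2.1.1 k ≠ 0 ∧ p (k, Y.2.1.2) ≠ 0 with hT
    have h := norm_sq_sectorGramF_le (L := L) (M := M) β F p Y (S := P) (fun k => hsup Y.2.1.1 Y.2.1.2 k) T
      (fun k h1 h2 => by rw [hT, mem_filter]; exact ⟨mem_univ _, h1, h2⟩)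
    refine h.trans (mul_le_mul_of_nonneg_left ?_ (by positivity))
    exact mul_le_mul_of_nonneg_right (hN Y.2.1.1 Y.2.1.2) hP0
  have hGY : ∀ Y' : SpaceTimeIdx L M × SectorLeg N,
      ‖sectorGramG L M β F p Y'‖ ^ 2 ≤ ‖((1 / (β * (L : ℝ) ^ 2) : ℝ) : ℂ)‖ ^ 2 * (Ns * P) := by
    intro Y'
    set T := (univ : Finset (FreqMomentum L M)).filter fun k => F Y'.2.1.1 k ≠ 0 ∧ p (k, Y'.2.1.2) ≠ 0 with hT
    have h := norm_sq_sectorGramG_le (L := L) (M := M) β F p Y' (S := P) (fun k => hsup Y'.2.1.1 Y'.2.1.2 k) T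
      (fun k h1 h2 => by rw [hT, mem_filter]; exact ⟨mem_univ _, h1, h2⟩)
    refine h.trans (mul_le_mul_of_nonneg_left ?_ (by positivity))
    exact mul_le_mul_of_nonneg_right (hN Y'.2.1.1 Y'.2.1.2) hP0
  refine isGramBoundedR_of_gram (fun Y : SpaceTimeIdx L M × SectorLeg N => decide (Y.2.2 = 0))
    ((sectorSubMatrix L M β F).transpose * normalCovariance L M p * sectorSubMatrix L M β F)
    (fun Y Y' h => pullback_normalCovariance_apply_of_charge_eq β F p (fin_two_eq_of_decide_eq' h))
    (sectorGramF L M β F p) (sectorGramG L M β F p) (Real.sqrt_nonneg _) (fun Y _ => ?_) (fun Y' _ => ?_)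
    (fun Y Y' hY hY' => ?_)
  · rw [← Real.sqrt_sq (norm_nonneg (sectorGramF L M β F p Y))]
    exact Real.sqrt_le_sqrt (hFY Y)
  · rw [← Real.sqrt_sq (norm_nonneg (sectorGramG L M β F p Y'))]
    exact Real.sqrt_le_sqrt (hGY Y')
  · have h0 : Y.2.2 = 0 := of_decide_eq_true hY
    have h1 : Y'.2.2 = 1 := by
      have hne : Y'.2.2 ≠ 0 := fun h => by simp [h] at hY'
      exact Fin.eq_one_of_ne_zero _ hne
    exact contr_pullback_normalCovariance_eq_inner β F p h0 h1

/-- **Entry (sup) bound of a sectorised normal covariance** from the same count: for every pair of labels,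
`‖(S(F)ᵀ·normalCovariance p·S(F)) Y Y′‖ ≤ ‖(βL²)⁻¹‖²·(Ns·P)` (closed form `sectorSub_pullback_normalCovariance_apply`: a Fourier sum of
`F_ω F_{ω′} p` over the joint support of `F_ω` and `p`, plane waves of modulus `1`). [cite: BenfattoGiulianiMastropietro2006, §2.7 (2.66)–(2.67)] -/
theorem norm_sectorSub_pullback_normalCovariance_le_of_count [NeZero M] (β : ℝ) (F : Fin N → FreqMomentum L M → ℂ)
    (hF : ∀ ω k, ‖F ω k‖ ≤ 1) (p : FreqMomentum L M × Fin 2 → ℂ) {P : ℝ} (hP0 : 0 ≤ P) (hp : ∀ ks, ‖p ks‖ ≤ P) {Ns : ℝ}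
    (hN : ∀ (ω : Fin N) (σ : Fin 2),
      (((univ : Finset (FreqMomentum L M)).filter fun k => F ω k ≠ 0 ∧ p (k, σ) ≠ 0).card : ℝ) ≤ Ns)
    (Y Y' : SpaceTimeIdx L M × SectorLeg N) :
    ‖((sectorSubMatrix L M β F).transpose * normalCovariance L M p * sectorSubMatrix L M β F) Y Y'‖ ≤
      ‖((1 / (β * (L : ℝ) ^ 2) : ℝ) : ℂ)‖ ^ 2 * (Ns * P) := by
  classical
  have hNs0 : 0 ≤ Ns := le_trans (Nat.cast_nonneg _) (hN Y.2.1.1 Y.2.1.2)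
  have hRHS : 0 ≤ ‖((1 / (β * (L : ℝ) ^ 2) : ℝ) : ℂ)‖ ^ 2 * (Ns * P) := by positivity
  rw [sectorSub_pullback_normalCovariance_apply]
  by_cases hσ : Y.2.1.2 = Y'.2.1.2
  · rw [if_pos hσ]
    refine (norm_sum_le _ _).trans ?_
    set T := (univ : Finset (FreqMomentum L M)).filter fun k => F Y.2.1.1 k ≠ 0 ∧ p (k, Y.2.1.2) ≠ 0 with hT
    have hw : ∀ (c : Fin 2) (k : FreqMomentum L M) (x : SpaceTimeIdx L M), ‖(starRingEnd ℂ) (hubbardPlaneWave L M β c k x)‖ = 1 :=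
      fun c k x => by rw [RCLike.norm_conj, norm_hubbardPlaneWave]
    have hc0 : 0 ≤ ‖((1 / (β * (L : ℝ) ^ 2) : ℝ) : ℂ)‖ := norm_nonneg _
    refine (sum_le_card_mul_of_support _ (S := ‖((1 / (β * (L : ℝ) ^ 2) : ℝ) : ℂ)‖ ^ 2 * P) (fun k => ?_) T (fun k hk => ?_)).trans ?_
    · -- one term: `‖c F_ω(k) w̄‖·‖±p‖·‖c F_{ω'}(k) w̄′‖ ≤ ‖c‖²·P`
      have h1 := hF Y.2.1.1 k
      have h2 := hF Y'.2.1.1 k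
      have hpm : ∀ q : ℂ, ‖q‖ ≤ P → ‖(((1 / (β * (L : ℝ) ^ 2) : ℝ) : ℂ) * (F Y.2.1.1 k * (starRingEnd ℂ) (hubbardPlaneWave L M β Y.2.2 k Y.1))) * q *
          (((1 / (β * (L : ℝ) ^ 2) : ℝ) : ℂ) * (F Y'.2.1.1 k * (starRingEnd ℂ) (hubbardPlaneWave L M β Y'.2.2 k Y'.1)))‖ ≤
          ‖((1 / (β * (L : ℝ) ^ 2) : ℝ) : ℂ)‖ ^ 2 * P := by
        intro q hq
        rw [norm_mul, norm_mul, norm_mul, norm_mul, norm_mul, norm_mul, hw, hw, mul_one, mul_one]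
        have hn1 := norm_nonneg (F Y.2.1.1 k)
        have hq0 := norm_nonneg q
        calc ‖((1 / (β * (L : ℝ) ^ 2) : ℝ) : ℂ)‖ * ‖F Y.2.1.1 k‖ * ‖q‖ * (‖((1 / (β * (L : ℝ) ^ 2) : ℝ) : ℂ)‖ * ‖F Y'.2.1.1 k‖)
            ≤ ‖((1 / (β * (L : ℝ) ^ 2) : ℝ) : ℂ)‖ * 1 * P * (‖((1 / (β * (L : ℝ) ^ 2) : ℝ) : ℂ)‖ * 1) := by gcongr
          _ = ‖((1 / (β * (L : ℝ) ^ 2) : ℝ) : ℂ)‖ ^ 2 * P := by ring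
      split_ifs
      · exact hpm _ (hp _)
      · exact hpm _ (by rw [norm_neg]; exact hp _)
      · exact hpm _ (by rw [norm_zero]; exact hP0)
    · -- a nonzero term forces `F_ω(k) ≠ 0` and `p(k,σ) ≠ 0`
      rw [hT, mem_filter]
      refine ⟨mem_univ _, fun h0 => hk ?_, fun h0 => hk ?_⟩
      · simp only [h0, zero_mul, mul_zero, norm_zero]
      · have : (if Y.2.2 = 0 ∧ Y'.2.2 = 1 then p (k, Y.2.1.2) else if Y.2.2 = 1 ∧ Y'.2.2 = 0 then -p (k, Y.2.1.2) else 0) = 0 := by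
          simp only [h0, neg_zero, ite_self]
        rw [this, mul_zero, zero_mul, norm_zero]
    · calc (T.card : ℝ) * (‖((1 / (β * (L : ℝ) ^ 2) : ℝ) : ℂ)‖ ^ 2 * P)
          = ‖((1 / (β * (L : ℝ) ^ 2) : ℝ) : ℂ)‖ ^ 2 * ((T.card : ℝ) * P) := by ring
        _ ≤ ‖((1 / (β * (L : ℝ) ^ 2) : ℝ) : ℂ)‖ ^ 2 * (Ns * P) :=
            mul_le_mul_of_nonneg_left (mul_le_mul_of_nonneg_right (hN Y.2.1.1 Y.2.1.2) hP0) (by positivity)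
  · rw [if_neg hσ, norm_zero]; exact hRHS

/-! ## §2 The slice `C^K_{(Λ,Λ′]}` at zero seed, any family with a per-sector count of `{F_ω ≠ 0} ∩ shell` -/

omit [NeZero L] in
/-- A nonzero slice weight puts `k` on the shell `ω_k² + e_K(k⃗)² < Λ′²` (`support_sliceCutoff`). -/
theorem sq_add_sq_lt_of_sliceWeight_ne_zero [NeZero M] {β : ℝ} (μ : ℝ) (K : TrigPolyC4v) {Λ Λ' : ℝ} (hΛ : 0 < Λ) (hΛΛ' : Λ ≤ Λ')
    {k : FreqMomentum L M} (hw : (hubbardCutoffWeightCT L M β μ K Λ k : ℂ) - (hubbardCutoffWeightCT L M β μ K Λ' k : ℂ) ≠ 0) :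
    matsubaraFreq β M k.1 ^ 2 + nambuXiCT L μ K k.2 ^ 2 < Λ' ^ 2 := by
  have hw0 : hubbardCutoffWeightCT L M β μ K Λ k - hubbardCutoffWeightCT L M β μ K Λ' k ≠ 0 := by
    intro h0; apply hw; rw [← Complex.ofReal_sub, h0, Complex.ofReal_zero]
  have hw' : salmhoferCutoff ((matsubaraFreq β M k.1 ^ 2 + nambuXiCT L μ K k.2 ^ 2) / Λ ^ 2) -
      salmhoferCutoff ((matsubaraFreq β M k.1 ^ 2 + nambuXiCT L μ K k.2 ^ 2) / Λ' ^ 2) ≠ 0 := by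
    simpa only [hubbardCutoffWeightCT] using hw0
  exact (support_sliceCutoff hΛ hΛΛ' hw').2

/-- **Sector-resolved Gram constant of the sectorised slice** from a per-sector count of the family's support ON THE SHELL:
if `#{k : F_ω(k) ≠ 0 ∧ ω_k² + e_K(k⃗)² < Λ′²} ≤ Ns` for every `ω`, then `IsGramBoundedR (S(F)ᵀ·C^K_{(Λ,Λ′]}·S(F)) √(‖(βL²)⁻¹‖²·(Ns·2βL²/Λ))`.
[cite: BenfattoGiulianiMastropietro2006, §2.8 (2.80)] -/
theorem isGramBoundedR_sectorSub_sliceCT_of_count [NeZero M] {β : ℝ} (hβ : 0 < β) (μ : ℝ) (K : TrigPolyC4v) {Λ Λ' : ℝ}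
    (hΛ : 0 < Λ) (hΛΛ' : Λ ≤ Λ') (F : Fin N → FreqMomentum L M → ℂ) (hF : ∀ ω k, ‖F ω k‖ ≤ 1) {Ns : ℝ}
    (hN : ∀ ω : Fin N, (((univ : Finset (FreqMomentum L M)).filter fun k =>
      F ω k ≠ 0 ∧ matsubaraFreq β M k.1 ^ 2 + nambuXiCT L μ K k.2 ^ 2 < Λ' ^ 2).card : ℝ) ≤ Ns) :
    IsGramBoundedR ((sectorSubMatrix L M β F).transpose * hubbardCovSliceCT L M β μ 0 K Λ Λ' * sectorSubMatrix L M β F)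
      (Real.sqrt (‖((1 / (β * (L : ℝ) ^ 2) : ℝ) : ℂ)‖ ^ 2 * (Ns * (2 * (β * (L : ℝ) ^ 2) / Λ)))) := by
  classical
  rw [hubbardCovSliceCT_zero_seed]
  refine isGramBoundedR_sectorSub_normalCovariance_of_count β F hF _ (by positivity)
    (fun ks => norm_sliceSymbolCT_le hβ μ K hΛ hΛΛ' ks) fun ω σ => le_trans (Nat.cast_le.2 (card_le_card fun k hk => ?_)) (hN ω)
  rw [mem_filter] at hk ⊢
  exact ⟨hk.1, hk.2.1, sq_add_sq_lt_of_sliceWeight_ne_zero μ K hΛ hΛΛ' (mul_ne_zero_iff.1 hk.2.2).1⟩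

/-- **Entry bound of the sectorised slice** from the same count: `‖(S(F)ᵀ·C^K_{(Λ,Λ′]}·S(F)) Y Y′‖ ≤ ‖(βL²)⁻¹‖²·(Ns·2βL²/Λ)`.
[cite: BenfattoGiulianiMastropietro2006, §2.7 (2.66)–(2.67)] -/
theorem norm_sectorSub_sliceCT_le_of_count [NeZero M] {β : ℝ} (hβ : 0 < β) (μ : ℝ) (K : TrigPolyC4v) {Λ Λ' : ℝ}
    (hΛ : 0 < Λ) (hΛΛ' : Λ ≤ Λ') (F : Fin N → FreqMomentum L M → ℂ) (hF : ∀ ω k, ‖F ω k‖ ≤ 1) {Ns : ℝ}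
    (hN : ∀ ω : Fin N, (((univ : Finset (FreqMomentum L M)).filter fun k =>
      F ω k ≠ 0 ∧ matsubaraFreq β M k.1 ^ 2 + nambuXiCT L μ K k.2 ^ 2 < Λ' ^ 2).card : ℝ) ≤ Ns)
    (Y Y' : SpaceTimeIdx L M × SectorLeg N) :
    ‖((sectorSubMatrix L M β F).transpose * hubbardCovSliceCT L M β μ 0 K Λ Λ' * sectorSubMatrix L M β F) Y Y'‖ ≤
      ‖((1 / (β * (L : ℝ) ^ 2) : ℝ) : ℂ)‖ ^ 2 * (Ns * (2 * (β * (L : ℝ) ^ 2) / Λ)) := by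
  classical
  rw [hubbardCovSliceCT_zero_seed]
  refine norm_sectorSub_pullback_normalCovariance_le_of_count β F hF _ (by positivity)
    (fun ks => norm_sliceSymbolCT_le hβ μ K hΛ hΛΛ' ks) (fun ω σ => le_trans (Nat.cast_le.2 (card_le_card fun k hk => ?_)) (hN ω)) Y Y'
  rw [mem_filter] at hk ⊢
  exact ⟨hk.1, hk.2.1, sq_add_sq_lt_of_sliceWeight_ne_zero μ K hΛ hΛΛ' (mul_ne_zero_iff.1 hk.2.2).1⟩

end Summit.HubbardSuperconductivity.HubbardSuperconductivity.Theorems.TorusFourierL2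

end
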